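import Summits.HodgeConjecture.HodgeConjecture.Theorems.Ring2AbelianAllAndreWeilPlaneMoves
import Literature.AlgebraicGeometry.HodgeTheory.AbelianVarietyEndomorphismsHOne
import HarnessLib

/-!
# Ring 2 · sub-cell AbelianAll (ALL ABELIAN VARIETIES), André axis, part XLII-d — THE WEIL LINES FROM A FIBRE CHART: the eigen-data of
# part XLII-b read off the tree's Weil eigenclasses `E₊`, `E₋ = conj E₊` of a chart `(A, φ_A)` of the fibre

HONEST FRAMING (page 1, verbatim): **research route, not a corollary; conditional on HC_CM plus one named
minimal statement.** Cell line: research route conditional on HC_CM; not a corollary; Q11.4-sentence-2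
already refuted in dim ≥ 3. Nothing in this file proves a case of the Hodge conjecture for an abelian variety, nor `B(X)` for a new `X`;
`HC_CM` (`Theses.RankFourFaces.CMAbelianHodge`) does not occur in this file; item `Theses.RankFourFaces.CMToAbelian` (stmt-16267)
OPEN and not closed here. Seat `pub-hodge-ring2-ab-andre-2`, gen 34; owed item (o131) in its smallest honest form.

Part XLII-b's criterion takes as data two eigenvectors `x_b`, `x_c = conj x_b` of the fibre action `φ_t^*` of an `S`-endomorphism. THIS FILE reads
them off the tree's named Weil spaces (van Geemen 4.9; `HodgeTheory/WeilClasses`): for a chart `e : A ≅ X_t` by a complex abelian variety with an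
endomorphism `φ_A` (intended `φ_A² = −d_K`, `K = ℚ(√−d_K) ↪ End⁰`) under which `φ_t` is `x·𝟙_A + y·φ_A` (`e ≫ φ_t = (x𝟙 + yφ_A) ≫ e`), every class
`c ∈ E₊ = weilClassesPlus A φ_A n d_K` transported to `X_t` is a `φ_t^*`-eigenvector for `(x + iy√d_K)^{2n}` (**`map_fibreEndo_chart_of_weilClassesPlus`**),
every class of `E₋` one for `(x − iy√d_K)^{2n}` (**`…_of_weilClassesMinus`**), and complex conjugation carries the transported `E₊` into the
transported `E₋` (**`conjClass_chart_mem_weilClassesMinus`**; the tree's `conjClass_mem_weilClassesMinus`). Hence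
(**`exists_betaInverse_of_weilPlane_moves_chart`**) part XLII-b's «the Weil plane must move, and that suffices» with the Weil lines GIVEN BY NAME:
`x_b = (e⁻¹)^* c₊` for a non-zero `c₊ ∈ E₊`, `x_c = conj x_b`, the three hypotheses `hxb`, `hxc`, `hx` of XLII-b discharged; what remains displayed
is the `θ`-slot (`x_a = j_t^* u`, `u, u'` algebraic pairing non-trivially, eigenvalue `a`), the distinctness of `a, (x ± iy√d_K)^{2n}`, and the
spanning `j_t^* H^{2n}(𝒳) ⊆ ℂx_a + ℂx_b + ℂ conj x_b` (monodromy; print-true in the W₆ habitat).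

HONEST STATUS. Bookkeeping (transport of structure along the chart + the tree's Weil-class API); not located in print in this form; claimed only
as a formal object. GAP: none closed; N104 untouched; the cycle `M` is still to be found.
References: vanGeemen1994HodgeAV (4.9, proof of Lemma 5.2 (6), Thm. 4.3); VoisinHodgeI2002 (§6.1.3 Cor. 6.12); Kleiman1968AlgebraicCycles (2A11);
Deligne1982HodgeCycles (§4); FultonYoungTableaux1997 (App. B (1)).
-/

noncomputable section

set_option linter.dupNamespace false

namespace Summit.HodgeConjecture.HodgeConjecture.Ring2.AbelianAll

open CategoryTheory CategoryTheory.Limits AlgebraicGeometry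
open Literature.AlgebraicGeometry Literature.AlgebraicGeometry.Motives
open Literature.AlgebraicGeometry.HodgeTheory
open Literature.AlgebraicTopology.SingularHomology (singularCohomology cupProduct)
open Summit.HodgeConjecture.HodgeConjecture.Theorems (deg_fiberGysin_aux)

/-! ## §1 Transport of the Weil eigenclasses along a chart -/

section Chart

variable {A : AbelianVariety ℂ} {Y : SchemeOver ℂ} (e : A.X ≅ Y) (φA : A ⟶ A) (ψ : Y ⟶ Y) (x y : ℕ)
  (hψ : e.hom ≫ ψ = (x • 𝟙 A + y • φA).hom.hom.hom ≫ e.hom)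

include hψ

/-- The chart turns `ψ^*` into `(x𝟙 + yφ_A)^*`: `ψ^* ((e⁻¹)^* c) = (e⁻¹)^* ((x𝟙 + yφ_A)^* c)`. [cite: FultonYoungTableaux1997, Appendix B §B.1 (1)] -/
theorem map_chart_apply (k : ℕ) (c : complexBetti A.X k) :
    (complexBetti.map ψ k).hom ((complexBetti.map e.inv k).hom c) =
      (complexBetti.map e.inv k).hom ((complexBetti.map (x • 𝟙 A + y • φA).hom.hom.hom k).hom c) := by
  have hid₁ : ∀ z : complexBetti Y k, (complexBetti.map e.inv k).hom ((complexBetti.map e.hom k).hom z) = z := fun z ↦ by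
    rw [← complexBetti.map_comp_apply, e.inv_hom_id, complexBetti.map_id]; rfl
  have hid₂ : ∀ w : complexBetti A.X k, (complexBetti.map e.hom k).hom ((complexBetti.map e.inv k).hom w) = w := fun w ↦ by
    rw [← complexBetti.map_comp_apply, e.hom_inv_id, complexBetti.map_id]; rfl
  have h1 : (complexBetti.map e.hom k).hom ((complexBetti.map ψ k).hom ((complexBetti.map e.inv k).hom c)) =
      (complexBetti.map (x • 𝟙 A + y • φA).hom.hom.hom k).hom c := by
    rw [← complexBetti.map_comp_apply e.hom ψ, hψ, complexBetti.map_comp_apply, hid₂]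
  rw [← h1, hid₁]

/-- **A transported `E₊`-class is a `ψ^*`-eigenvector for `(x + iy√d)^{2n}`.** [cite: vanGeemen1994HodgeAV, 4.9] -/
theorem map_fibreEndo_chart_of_weilClassesPlus {n dK : ℕ} {c : complexBetti A.X (2 * n)} (hc : c ∈ weilClassesPlus A φA n dK) :
    (complexBetti.map ψ (2 * n)).hom ((complexBetti.map e.inv (2 * n)).hom c) =
      (((x : ℂ) + (y : ℂ) * Complex.I * (Real.sqrt dK : ℂ)) ^ (2 * n)) • (complexBetti.map e.inv (2 * n)).hom c := by
  rw [map_chart_apply e φA ψ x y hψ, ← map_smul]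
  exact congrArg _ (mem_weilClassesPlus_iff.1 hc x y)

/-- **A transported `E₋`-class is a `ψ^*`-eigenvector for `(x − iy√d)^{2n}`.** [cite: vanGeemen1994HodgeAV, 4.9] -/
theorem map_fibreEndo_chart_of_weilClassesMinus {n dK : ℕ} {c : complexBetti A.X (2 * n)} (hc : c ∈ weilClassesMinus A φA n dK) :
    (complexBetti.map ψ (2 * n)).hom ((complexBetti.map e.inv (2 * n)).hom c) =
      (((x : ℂ) - (y : ℂ) * Complex.I * (Real.sqrt dK : ℂ)) ^ (2 * n)) • (complexBetti.map e.inv (2 * n)).hom c := by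
  rw [map_chart_apply e φA ψ x y hψ, ← map_smul]
  exact congrArg _ (mem_weilClassesMinus_iff.1 hc x y)

omit hψ in
/-- **Conjugation carries the transported `E₊` into the transported `E₋`**: `conj ((e⁻¹)^* c) = (e⁻¹)^* (conj c)` with `conj c ∈ E₋` (the tree's
`conjClass_mem_weilClassesMinus`: the two Weil lines are complex conjugate). [cite: vanGeemen1994HodgeAV, proof of Lemma 5.2 (6)] [cite: VoisinHodgeI2002, §6.1.3 Cor. 6.12] -/
theorem conjClass_chart_mem_weilClassesMinus {n dK : ℕ} {c : complexBetti A.X (2 * n)} (hc : c ∈ weilClassesPlus A φA n dK) :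
    conjClass (ComplexPoints Y) (2 * n) ((complexBetti.map e.inv (2 * n)).hom c) =
      (complexBetti.map e.inv (2 * n)).hom (conjClass (ComplexPoints A.X) (2 * n) c) ∧
    conjClass (ComplexPoints A.X) (2 * n) c ∈ weilClassesMinus A φA n dK :=
  ⟨conjClass_map_complexBetti e.inv (2 * n) c, conjClass_mem_weilClassesMinus hc⟩

omit hψ in
/-- A transported non-zero class is non-zero (`e` is an isomorphism). [folklore] -/
theorem map_chart_ne_zero {k : ℕ} {c : complexBetti A.X k} (hc : c ≠ 0) : (complexBetti.map e.inv k).hom c ≠ 0 := fun h ↦ hc (by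
  have h' := congrArg (complexBetti.map e.hom k).hom h
  rwa [← complexBetti.map_comp_apply, e.hom_inv_id, complexBetti.map_id, map_zero] at h')

end Chart

variable {𝒳 S : SchemeOver ℂ} {d : ℕ} {f : 𝒳 ⟶ S} (hf : IsCompactAbelianPencil f d)

/-- `𝐆[hf, s, k]` — `j_{s*} : Hᵏ(X_s(ℂ); ℂ) → H^{k+2}(𝒳(ℂ); ℂ)` for the complex orientations (display notation, as in part XL-a).
[cite: FultonYoungTableaux1997, Appendix B §B.1 (5)] -/
local notation3 (prettyPrint := false) "𝐆[" hf ", " s ", " k "]" =>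
  complexGysin complexOrientationFamily (IsCompactAbelianPencil.isSmoothProjective_fiberOver hf s)
    (IsCompactAbelianPencil.isSmoothProjective_total hf) (fiberι f s) (deg_fiberGysin_aux k d)

/-- `𝐣[s, k]` — `j_s^* : Hᵏ(𝒳(ℂ); ℂ) → Hᵏ(X_s(ℂ); ℂ)` as a linear map (display notation). [cite: VoisinHodgeI2002, §7.3.2] -/
local notation3 (prettyPrint := false) "𝐣[" s ", " k "]" => (complexBetti.map (fiberι f s) k).hom

/-! ## §2 The Weil plane must move — Weil lines by name -/

section Weil

/-- **β FROM A MOVED WEIL PLANE, THE WEIL LINES READ OFF A CHART OF WEIL TYPE.** Compact pencil `f : 𝒳 ⟶ S` of abelian `d`-folds, `q + 1 + p' = d`,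
an `S`-endomorphism `ψ` whose fibre action `ψ_t` is `x·𝟙_A + y·φ_A` in a chart `e : A ≅ X_t` (`φ_A` an endomorphism of the abelian variety `A`;
intended `φ_A² = −d_K`); the `θ`-slot as in part XLII-b (`u ∈ N^{q+1}(𝒳)`, `u' ∈ N^{p'}(𝒳)`, `x_a = j_t^*u ≠ 0` with `ψ_t^* x_a = a x_a`,
`∫_{X_t} j^*u ∪ j^*u' ≠ 0`); a NON-ZERO Weil eigenclass `c₊ ∈ E₊ = weilClassesPlus A φ_A (q+1) d_K` with `x_b := (e⁻¹)^* c₊`; the three scalars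
`a`, `b = (x + iy√d_K)^{2q+2}`, `c = (x − iy√d_K)^{2q+2}` distinct; and `j_t^* H^{2q+2}(𝒳) ⊆ ℂx_a + ℂx_b + ℂ conj x_b`. If some algebraic
`M : H^{2q+4}(𝒳) → H^{2q+2}(𝒳)` moves some `r x_b + s conj x_b` off `ℂx_a` under `j_t^* M j_{t*}`, then β holds at `t` in degree `2q+2` — part XLII-b
with `hxb`, `hxc`, `hx` supplied by §1. [cite: Kleiman1968AlgebraicCycles, Appendix to §2, Thm. 2A11] [cite: vanGeemen1994HodgeAV, 4.9 and Thm. 4.3]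
[cite: VoisinHodgeI2002, §6.1.3 Cor. 6.12] -/
theorem exists_betaInverse_of_weilPlane_moves_chart (t : ComplexPoints S) {q p' : ℕ} (hqp : q + 1 + p' = d)
    (ψ : 𝒳 ⟶ 𝒳) (hψf : ψ ≫ f = f) (ψt : fiberOver f t ⟶ fiberOver f t) (hψt : ψt ≫ fiberι f t = fiberι f t ≫ ψ)
    {A : AbelianVariety ℂ} (e : A.X ≅ fiberOver f t) (φA : A ⟶ A) (x y dK : ℕ)
    (hchart : e.hom ≫ ψt = (x • 𝟙 A + y • φA).hom.hom.hom ≫ e.hom)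
    {a : ℂ} (hab : a ≠ ((x : ℂ) + (y : ℂ) * Complex.I * (Real.sqrt dK : ℂ)) ^ (2 * (q + 1)))
    (hac : a ≠ ((x : ℂ) - (y : ℂ) * Complex.I * (Real.sqrt dK : ℂ)) ^ (2 * (q + 1)))
    (hbc : ((x : ℂ) + (y : ℂ) * Complex.I * (Real.sqrt dK : ℂ)) ^ (2 * (q + 1)) ≠ ((x : ℂ) - (y : ℂ) * Complex.I * (Real.sqrt dK : ℂ)) ^ (2 * (q + 1)))
    {u : complexBetti 𝒳 (2 * q + 2)} {u' : complexBetti 𝒳 (2 * p')} (hu : u ∈ algebraicClasses 𝒳 (q + 1)) (hu' : u' ∈ algebraicClasses 𝒳 p')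
    (hu0 : 𝐣[t, 2 * q + 2] u ≠ 0)
    (hpair : traceC (hf.isSmoothProjective_fiberOver t)
      (cupProduct (show 2 * q + 2 + 2 * p' = 2 * d by omega) (𝐣[t, 2 * q + 2] u) (𝐣[t, 2 * p'] u')) ≠ 0)
    (hxa : (complexBetti.map ψt (2 * q + 2)).hom (𝐣[t, 2 * q + 2] u) = a • 𝐣[t, 2 * q + 2] u)
    {cplus : complexBetti A.X (2 * (q + 1))} (hc : cplus ∈ weilClassesPlus A φA (q + 1) dK) (hc0 : cplus ≠ 0)
    (hspan : ∀ W, ∃ c₁ c₂ c₃ : ℂ, 𝐣[t, 2 * q + 2] W = c₁ • 𝐣[t, 2 * q + 2] u + c₂ • (complexBetti.map e.inv (2 * (q + 1))).hom cplus +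
      c₃ • conjClass (ComplexPoints (fiberOver f t)) (2 * q + 2) ((complexBetti.map e.inv (2 * (q + 1))).hom cplus))
    (M : complexBetti 𝒳 (2 * q + 2 + 2) →ₗ[ℂ] complexBetti 𝒳 (2 * q + 2)) (algM : IsAlgebraicCorrespondence (d + 1) (d + 1) 𝒳 𝒳 M)
    {r s : ℂ} (hmove : 𝐣[t, 2 * q + 2] (M (𝐆[hf, t, 2 * q + 2] (r • (complexBetti.map e.inv (2 * (q + 1))).hom cplus +
      s • conjClass (ComplexPoints (fiberOver f t)) (2 * q + 2) ((complexBetti.map e.inv (2 * (q + 1))).hom cplus)))) ∉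
      Submodule.span ℂ {𝐣[t, 2 * q + 2] u}) :
    ∃ T : complexBetti 𝒳 (2 * q + 2 + 2) →ₗ[ℂ] complexBetti 𝒳 (2 * q + 2),
      IsAlgebraicCorrespondence (d + 1) (d + 1) 𝒳 𝒳 T ∧
        ∀ W, 𝐣[t, 2 * q + 2] (T (𝐆[hf, t, 2 * q + 2] (𝐣[t, 2 * q + 2] W))) = 𝐣[t, 2 * q + 2] W := by
  obtain ⟨hconj, hminus⟩ := conjClass_chart_mem_weilClassesMinus e φA hc
  have hxb := map_fibreEndo_chart_of_weilClassesPlus e φA ψt x y hchart hc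
  have hxc := map_fibreEndo_chart_of_weilClassesMinus e φA ψt x y hchart hminus
  rw [← hconj] at hxc
  exact exists_betaInverse_of_weilPlane_moves hf t hqp ψ hψf ψt hψt hab hac hbc hu hu' hu0 hpair hxa hxb hxc hspan rfl
    (map_chart_ne_zero e hc0) M algM hmove

end Weil

end Summit.HodgeConjecture.HodgeConjecture.Ring2.AbelianAll

end
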